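import Summits.NavierStokesRegularity.NavierStokesRegularity.Theses.QuantisedSymmetry
import Summits.NavierStokesRegularity.NavierStokesRegularity.Theses.Blowup
import Literature.Analysis.FluidPDE.SelfSimilarLiouville
import HarnessLib

/-!
# Route `QuantisedSymmetry`, crux `PolyhedralDssProfileExists` (X⁻, stmt-NavierStokesRegularity-1404) —
# domination of `Blowup.BlowupTypeIDssProfile` (stmt-NavierStokesRegularity-0155); registered stub
# `stub_dominatesBlowupProfile` of line `polyhedral_cell` (lead c15)

A polyhedrally-equivariant Type-I `λ`-DSS nontrivial ancient mild profile is in particular a Type-I `λ`-DSS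
nontrivial ancient mild profile with measurable slices, i.e. a counterexample to
`Literature.Analysis.FluidPDE.TypeIDSSLiouville λ`; hence X⁻ implies the sector-agnostic existence crux
`Blowup.BlowupTypeIDssProfile = ¬ ∀ λ, TypeIDSSLiouville λ ∧ ∀ R, RotatedTypeIDSSLiouville λ R` of route `Blowup`
(the negation of Tsai's Type-I (rotated) DSS Liouville conjecture). Since the truncation bridge is proved for every
profile (`quantisedSymmetry_polyhedralTruncationBridge_proof` via `filamentSkeletonRss_rdssProfileTruncation_proof`), the
group-theoretic clauses of X⁻ are load-bearing nowhere on the summit path: X⁻ is the sector restriction of 0155.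
-/

set_option linter.dupNamespace false

namespace Summit.NavierStokesRegularity.NavierStokesRegularity.Theorems.PolyhedralDssProfileExists.PolyhedralCell

open MeasureTheory
open Literature.Analysis.FluidPDE

/-- **X⁻ negates Tsai's Type-I `λ`-DSS Liouville statement at its own factor**: a witness `(G, λ, u)` of
`PolyhedralDssProfileExists` gives `¬ TypeIDSSLiouville λ` for its `λ > 1` (the profile is ancient mild with
measurable slices, `λ`-DSS, Type I and not a.e. trivial). [folklore] -/
theorem exists_not_typeIDSSLiouville_of_polyhedralDssProfileExists
    (hX : _root_.Summit.NavierStokesRegularity.NavierStokesRegularity.Theses.QuantisedSymmetry.PolyhedralDssProfileExists) :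
    ∃ c : ℝ, 1 < c ∧ ¬ TypeIDSSLiouville c := by
  obtain ⟨G, -, -, -, c, hc, u, hanc, hmeas, hdss, hdec, -, hnt⟩ := hX
  exact ⟨c, hc, fun hL => hnt (hL hc u hanc hmeas hdss hdec)⟩

/-- **REGISTERED STUB `stub_dominatesBlowupProfile` (line `polyhedral_cell`, lead c15): X⁻ implies
`Blowup.BlowupTypeIDssProfile`** (stmt-NavierStokesRegularity-0155): the polyhedral profile's factor `λ` refutes
the `TypeIDSSLiouville λ` conjunct of `∀ λ, TypeIDSSLiouville λ ∧ ∀ R, RotatedTypeIDSSLiouville λ R`. An implication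
between two OPEN cruxes (it closes neither). [folklore] -/
theorem stub_dominatesBlowupProfile :
    _root_.Summit.NavierStokesRegularity.NavierStokesRegularity.Theses.QuantisedSymmetry.PolyhedralDssProfileExists →
      _root_.Summit.NavierStokesRegularity.NavierStokesRegularity.Theses.Blowup.BlowupTypeIDssProfile := by
  intro hX
  obtain ⟨c, -, hc⟩ := exists_not_typeIDSSLiouville_of_polyhedralDssProfileExists hX
  dsimp only [_root_.Summit.NavierStokesRegularity.NavierStokesRegularity.Theses.Blowup.BlowupTypeIDssProfile]
  exact fun hL => hc (hL c).1

end Summit.NavierStokesRegularity.NavierStokesRegularity.Theorems.PolyhedralDssProfileExists.PolyhedralCell
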